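import Summits.HodgeConjecture.HodgeConjecture.Theorems.R90S6TwistedHyperbolicHeckeFL      -- ★ TB2d FILE A (p04): (A.1) `epsKappaOrbitalIntegral_eq_mul_classEpsOrbitalIntegral_of_unique` (general `κ`); brings ★ `Ch4Sec10` (`PhiEpsKappa`, `DeltaTilde`, `IsEndoMatch`), ★ `stableOrbitalIntegralRel_eq_classOrbitalIntegral_of_unique`
import Summits.HodgeConjecture.HodgeConjecture.Theorems.R90S6TwistedNormFibreSum          -- ★ TB2d FILE B (p04): (B.4) `cast_sum_normFibre_card_cells_eq_mul_coeff_satakeTransform_bcGraphPartner` (brings ★ TB3 `coeff_satakeTransform_bcGraphPartner`)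
import Summits.HodgeConjecture.HodgeConjecture.Theorems.R90S6SatakeCoeffEtaOnePartner      -- ★ TE3 (p04): `coeff_satakeTransform_etaOneGraphPartner` (brings ★ W10 `etaOneGraphPartnerAlgHom` = `η̂₁`)
import HarnessLib

/-!
# R90 · S6 «Ch. 14.1–14.5 stable trace formula» — card K8 FILE 2a (row E1.4.4.3.1): THE ε-SPLIT (HYPERBOLIC) CLAUSE OF THE `η̂₁` TWISTED FL (4.10.3) FROM VALUE
# BINDERS, AND THE CONSTANT-TERM COMPATIBILITY `η̂₁` vs `b` (`Theorems/R90S6EtaOneTwistedHyperbolicFL.lean`)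

Dealer R90-C14-plan (g2) ruling 02:47:13Z («FILE 2 (hyperbolic `η̂₁` clause) = a COROLLARY of p04's TB2d (split `T` ⇒ one surviving ε-class ⇒ `TO^{κ̃} = κ̃(ν₀)·TO`) ∘
constant-term compatibility of `η̂₁` vs `b`»), standing deal l.11408 («FILE 2 census when p04 C lands»; ★ TB2d FILE C 03:31Z); census + heads R90 bus 03:37Z to dealer (g3).
Seat R90-C14-p08 (g2).  Lane `--kind proof --supports stmt-HodgeConjecture-24833 --as helper`; THEOREMS ONLY (no definition, no instance, no notation, no named fact, no kit,
no `sorry`); imports ★ TB2d FILE A + ★ TB2d FILE B + ★ TE3 + HarnessLib.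

## THE PRINT
[Rogawski1990, §4.10 Prop. 4.10.1 (b) (4.10.3) p. 58]: `Δ̃(δ)Φ^κ_ε(δ, φ) = Φ^st(γ, φ^H)`, `φ^H = η̂₁(φ)` for `φ ∈ ℋ̃`; (4.10.1) `Φ^κ_ε(δ, φ) = Σ_ν κ(ν) e(δ^ν) Φ_ε(δ^ν, φ)`;
`Δ̃(δ) = μ(det₀ δ)⁻¹ Δ_{G∕H}(γ)`; proof of Prop. 4.10.2 p. 58: «if `δ = d(x, y, z) ∈ M̃`, then `γ = d(x∕z̄, y∕ȳ, z∕x̄)`, `τ̃(δ) = μ(xz)⁻¹τ(γ) = 1`» — at an ε-SPLIT `δ` the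
factor `Δ̃(δ)` is the bare `D_{G∕H}(γ)`.  At such `δ` exactly ONE ε-class inside `𝒪_{ε-st}(δ)` meets the support of a Hecke shell (the selection rule, ★ L2-sgn ∕ ★ K7 (K7.5) ∕
★ TB2d (C.2)), and on `H = U(2) × U(1)` the stable class of the hyperbolic `γ` is one conjugacy class; both surviving orbital integrals are CONSTANT TERMS (★ TB2a + TJ1 on
`G̃`, ★ (B2a) FILE 3 on `H`), and the Satake graphs identify their coefficients: the `U(1,1)`-line coefficient of `𝒮_w(η̂₁ φ)` at `ℓ′_k = (k, −k)` and the `U(3)`-line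
coefficient of `𝒮_w(b φ)` at `ℓ_k = (k, 0, −k)` are the SAME norm-fibre sum `Σ_{μ₀ − μ₂ = k}(𝒮^{GL}φ)_μ` (★ TE3, ★ TB3).

## WHAT IS PROVED (namespace `Summit.HodgeConjecture.HodgeConjecture.R90.S6`)
* §1 (H.1) **`delta_mul_epsKappaOrbitalIntegral_eq_stableOrbitalIntegralRel_of_values`** — ★ TB2d (A.2)'s twin for a GENERAL class character `κ` and a transfer-factor
  letter `Δ : ℂ`: one surviving class `c₀` (`hc₀`, `hsel`, `he : e(δ_{c₀}) = 1`), the H-side one-class binders (`hrefl`, `huniq`), value binders `hTO : Φ_ε(δ_{c₀}, φ) = J·S`,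
  `hΦH : Φ(⟦γ⟧, f^H) = X·S₂` and the scalar junction `hJS : Δ·κ(δ, c₀)·(J·S) = X·S₂` ⟹ `Δ · Φ^κ_ε(δ, φ) = Φ^st_H(γ, f^H)`.
  (H.2) **`deltaTilde_mul_phiEpsKappa_eq_stableOrbitalIntegralRel_of_values`** — (H.1) at a ★ `TwistedTransferData` `𝔡` (`stε = 𝔡.stEps` at `𝔡.iotaHt δ`,
  `κ = 𝔡.kappa`, `e = 𝔡.kottwitzSign`, `Δ = 𝔡.DeltaTilde δ γ`, `st_H = 𝔡.IsStConjH`): the conclusion is the `(δ, γ)`-clause of ★ `IsEndoMatch 𝔡 mt mH φ φH` VERBATIM.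
* §2 (H.3) **`coeff_satakeTransform_etaOneGraphPartner_eq_coeff_satakeTransform_bcGraphPartner`** — CONSTANT-TERM COMPATIBILITY: `(𝒮_w(η̂₁ φ))_{ℓ′_k} = (𝒮_w(b φ))_{ℓ_k}`
  for every `φ ∈ ℋ(GL₃(K), GL₃(𝒪))`, `k ∈ ℤ` (★ TE3 ∘ ★ TB3); (H.4) **`cast_sum_normFibre_card_cells_eq_mul_coeff_satakeTransform_etaOneGraphPartner`** — ★ TB2d (B.4)
  re-read through (H.3): the ε-norm-fibre cell count of ★ TB2d (C.3) is `N_k(λ) = u^{2k} · (𝒮_w(η̂₁ c_λ))_{ℓ′_k}`, i.e. the G̃-side value of the hyperbolic clause IS the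
  `U(1,1)` constant-term coefficient of `η̂₁ c_λ` that the H-side engine ★ (B2a) FILE 3 produces — the `S ↔ S₂` half of the junction `hJS`.
FILE 2b (the concrete CM-place head = the `η̂₁` twin of p09's ★ `stableOrbitalIntegralRel_coeff_toVector_eq_finsum_finExplicitDelta_of_levi_of_frames`, binding ★ TB2d (C.3),
★ (B2a) FILE 3, `Δ̃ = D_{G∕H}` and (H.4)) follows on the dealer's word.
HONEST LABEL: composition layer over value binders; the Haar constant `c` and `μAT(U₀)` of ★ TB2d (C.3), the `ℝ≥0∞ → ℂ` reading, and the `K = L_w` junction stay the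
assembling seat's; nothing here proves (4.10.3) or discharges a citation.  HC_CM is proved only modulo the 7 printed citations (2 remaining named inputs: hLiu418 =
stmt-HodgeConjecture-24832, h413 = stmt-HodgeConjecture-24833) until rung 0 closes; REL ≠ ★ ≠ BUILT.

## Tree search (dedup)
`rg "delta_mul_epsKappaOrbitalIntegral|deltaTilde_mul_phiEpsKappa|etaOneGraphPartner_eq_coeff_satakeTransform_bcGraphPartner|satakeTransform_etaOneGraphPartner$"` over `lean/` —
no hit (2026-09-05T03:40Z); nearest ★ TB2d (A.2)/(A.3) (`κ ≡ 1`, no `Δ`), ★ TE3, ★ TB3, ★ (B.4).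

## References
* [Rogawski1990] J. D. Rogawski, *Automorphic Representations of Unitary Groups in Three Variables*, Ann. of Math. Stud. 123 (1990): §4.10 (4.10.1)–(4.10.3), Prop. 4.10.1 (b),
  Prop. 4.10.2 pp. 57–59; §4.9 p. 55, Lemma 4.9.2 p. 56; §3.13 Prop. 3.13.1 p. 38.
* [CartierCorvallis1979] P. Cartier, *Representations of 𝔭-adic groups: a survey*, PSPM 33.1 (1979): §IV (4.2) p. 146, Cor. 4.2.
* [Kottwitz1986BaseChangeUnits] R. E. Kottwitz, *Base change for unit elements of Hecke algebras*, Compositio Math. 60 (1986): §1 pp. 239–243, §3.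
-/

set_option autoImplicit false
-- the mandated namespace repeats the single-problem summit's segment (`HodgeConjecture.HodgeConjecture`)
set_option linter.dupNamespace false

noncomputable section

open MeasureTheory
open scoped MatrixGroups ValuativeRel
open NumberField IsDedekindDomain
open Literature.NumberTheory.Rogawski1990 Literature.NumberTheory.Rogawski1990.Ch4Sec10 Literature.NumberTheory.Automorphic
  Literature.NumberTheory.Automorphic.HermitianLattice Literature.NumberTheory.Automorphic.UnitaryGroup

namespace Summit.HodgeConjecture.HodgeConjecture.R90.S6

universe u

/-! ## §1 The ε-split clause of (4.10.3) from value binders -/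

section Values

variable {Gt : Type*} [Group Gt] (ε : Gt →* Gt) {Z' : Subgroup Gt} [∀ δ : Gt, MeasurableSpace (Gt ⧸ epsCentralizer ε δ)]
  {H : Type*} [Group H] [∀ a : H, MeasurableSpace (H ⧸ Subgroup.centralizer ({a} : Set H))]

/-- **(H.1) THE ε-SPLIT (HYPERBOLIC-NORM) CLAUSE OF THE `η̂₁` TWISTED FL (4.10.3), FROM VALUE BINDERS.**  Over abstract carriers (`G̃` with `ε`, classes modulo `Z′`,
stable ε-class relation `stε`, class character `κ` — (4.10.1)'s `κ(ν) = μ(det₀(t_ν))⁻¹` —, signs `e`, twisted family `mt`, `φ : G̃ → ℂ`, `δ ∈ G̃`; the endoscopic group `H`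
with stable conjugacy `st_H`, family `mH`, `f^H : H → ℂ`, `γ ∈ H`; a transfer-factor letter `Δ : ℂ`): if (i) ONE ε-class `c₀ ⊂ 𝒪_{ε-st}(δ)` carries `φ` (`hc₀`, `hsel` — the
selection rule at an ε-split `δ`, ★ L2-sgn ∕ ★ K7 (K7.5) ∕ ★ TB2d (C.2)) and `e(δ_{c₀}) = 1`; (ii) the stable class of the hyperbolic `γ` in `H` is its conjugacy class (`hrefl`,
`huniq`); (iii) `Φ_ε(δ_{c₀}, φ; m_{c₀}) = J · S` (`hTO`, ★ TB2d (C.3)'s shape); (iv) `Φ(⟦γ⟧, f^H) = X · S₂` (`hΦH`, ★ (B2a) FILE 3's shape); (v) the SCALAR JUNCTION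
`Δ · κ(δ, c₀) · (J · S) = X · S₂` (`hJS`; `Δ̃(δ) = D_{G∕H}(γ)` at ε-split `δ` since `τ̃(δ) = 1`, p. 58, and `S ↔ S₂` by (H.4)) — then `Δ · Φ^κ_ε(δ, φ) = Φ^st_H(γ, f^H)`.
[cite: Rogawski1990, §4.10 (4.10.1), (4.10.3), Prop. 4.10.1 (b), Prop. 4.10.2 pp. 57–59] [cite: CartierCorvallis1979, §IV (4.2) p. 146] -/
theorem delta_mul_epsKappaOrbitalIntegral_eq_stableOrbitalIntegralRel_of_values (stε : Gt → Gt → Prop) (κ : Gt → EpsConjClassesMod ε Z' → ℂ)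
    (e : Gt → ℂ) (mt : EpsOrbitalMeasureFamily ε Z') (φ : Gt → ℂ) (δ : Gt) (c₀ : EpsConjClassesMod ε Z') (hc₀ : stε δ (Quotient.out c₀))
    (hsel : ∀ c : EpsConjClassesMod ε Z', stε δ (Quotient.out c) → c ≠ c₀ → classEpsOrbitalIntegral ε mt φ c = 0)
    (he : e (Quotient.out c₀) = 1)
    (stH : H → H → Prop) (mH : OrbitalMeasureFamily H) (fH : H → ℂ) (γ : H)
    (hrefl : ∀ a' : H, IsConj γ a' → stH γ a') (huniq : ∀ k : H, stH γ k → IsConj γ k)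
    (Δ : ℂ) {J S X S₂ : ℂ}
    (hTO : classEpsOrbitalIntegral ε mt φ c₀ = J * S)
    (hΦH : classOrbitalIntegral mH fH (ConjClasses.mk γ) = X * S₂)
    (hJS : Δ * κ δ c₀ * (J * S) = X * S₂) :
    Δ * epsKappaOrbitalIntegral ε stε κ e mt φ δ = stableOrbitalIntegralRel stH mH fH γ := by
  rw [epsKappaOrbitalIntegral_eq_mul_classEpsOrbitalIntegral_of_unique ε stε κ e mt φ δ c₀ hc₀ hsel, he, mul_one, hTO, ← mul_assoc, hJS,
    stableOrbitalIntegralRel_eq_classOrbitalIntegral_of_unique stH mH fH γ hrefl huniq, hΦH]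

/-- **(H.2) THE SAME CLAUSE AT A TWISTED TRANSFER DATUM** (★ `TwistedTransferData` `𝔡`: `stε = 𝔡.stEps` at `𝔡.iotaHt δ`, `κ = 𝔡.kappa`, `e = 𝔡.kottwitzSign`,
`Δ = 𝔡.DeltaTilde δ γ = μ(det₀ δ)⁻¹ Δ_{G∕H}(γ)`, `st_H = 𝔡.IsStConjH`): under the binders of (H.1), `Δ̃(δ) · Φ^κ_ε(δ, φ) = Φ^st(γ, φ^H)` in the letters of ★ `DeltaTilde` ∕
★ `PhiEpsKappa` ∕ ★ `stableOrbitalIntegralRel` — VERBATIM the `(δ, γ)`-clause of ★ `IsEndoMatch 𝔡 mt mH φ φH` («`φ^H` is a twisted endoscopic transfer of `φ`», (4.10.3)),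
to be fed `IsNormH δ γ` ∕ `IsGRegularH γ` by the assembling seat. [cite: Rogawski1990, §4.10 Prop. 4.10.1 (b), (4.10.3) p. 58] -/
theorem deltaTilde_mul_phiEpsKappa_eq_stableOrbitalIntegralRel_of_values {G Ht CharM : Type*} [Group G] [Group Ht]
    (𝔡 : TwistedTransferData Gt G Ht H CharM ε Z') (mt : EpsOrbitalMeasureFamily ε Z') (mH : OrbitalMeasureFamily H)
    (φ : Gt → ℂ) (φH : H → ℂ) (δ : Ht) (γ : H) (c₀ : EpsConjClassesMod ε Z') (hc₀ : 𝔡.stEps (𝔡.iotaHt δ) (Quotient.out c₀))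
    (hsel : ∀ c : EpsConjClassesMod ε Z', 𝔡.stEps (𝔡.iotaHt δ) (Quotient.out c) → c ≠ c₀ → classEpsOrbitalIntegral ε mt φ c = 0)
    (he : 𝔡.kottwitzSign (Quotient.out c₀) = 1)
    (hrefl : ∀ a' : H, IsConj γ a' → 𝔡.IsStConjH γ a') (huniq : ∀ k : H, 𝔡.IsStConjH γ k → IsConj γ k)
    {J S X S₂ : ℂ}
    (hTO : classEpsOrbitalIntegral ε mt φ c₀ = J * S)
    (hΦH : classOrbitalIntegral mH φH (ConjClasses.mk γ) = X * S₂)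
    (hJS : 𝔡.DeltaTilde δ γ * 𝔡.kappa (𝔡.iotaHt δ) c₀ * (J * S) = X * S₂) :
    𝔡.DeltaTilde δ γ * 𝔡.PhiEpsKappa mt φ (𝔡.iotaHt δ) = stableOrbitalIntegralRel 𝔡.IsStConjH mH φH γ :=
  delta_mul_epsKappaOrbitalIntegral_eq_stableOrbitalIntegralRel_of_values ε 𝔡.stEps 𝔡.kappa 𝔡.kottwitzSign mt φ (𝔡.iotaHt δ) c₀ hc₀ hsel he
    𝔡.IsStConjH mH φH γ hrefl huniq (𝔡.DeltaTilde δ γ) hTO hΦH hJS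

end Values

/-! ## §2 Constant-term compatibility of `η̂₁` with `b`: the coefficient seam of the hyperbolic clause -/

section Adic

variable {F E : Type} [Field F] [NumberField F] [Field E] [NumberField E] [Algebra F E] [Algebra.IsQuadraticExtension F E]
  (c : E ≃ₐ[F] E) (hc1 : c ≠ 1) (v : HeightOneSpectrum (𝓞 F)) (w : PlacesOver E v) (hw : c • w.1 = w.1)
  (hv : Algebra.IsUnramifiedIn (𝓞 E) v.asIdeal)
  {K : Type u} [Field K] [ValuativeRel K] [IsDiscreteValuationRing 𝒪[K]] [Finite 𝓀[K]] {ϖ : K}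
  [IsHeckeTriple (⊤ : Submonoid (GL (Fin 3) K)) (glInt 3 K) (glInt 3 K)]
  (hϖ : IsUniformizingElement ϖ) {u : ℂˣ} (hu : (u : ℂ) ^ 2 = ((Nat.card 𝓀[K] : ℕ) : ℂ))
  {wt : Multiplicative (Fin 3 → ℤ) →* ℂ}
  (hwt : ∀ e : Fin 3 → ℤ, wt (Multiplicative.ofAdd e) = ((u ^ ((((3 : ℕ) : ℤ) - 1) * (∑ i, e i) - 2 * satakeTwistExp e) : ℂˣ) : ℂ))

/-- **(H.3) CONSTANT-TERM COMPATIBILITY OF `η̂₁` WITH `b`**: at an inert unramified place `w ∣ v`, for every unramified datum `hd` at `w`, every `φ ∈ ℋ(GL₃(K), GL₃(𝒪))`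
and every `k ∈ ℤ`, the `U(1,1)`-line Satake coefficient of `η̂₁ φ` at `ℓ′_k = (k, −k)` EQUALS the `U(3)`-line Satake coefficient of the base-change partner `b φ` at
`ℓ_k = (k, 0, −k)` — both are the norm-fibre sum `Σ_{μ₀ − μ₂ = k}(𝒮^{GL}φ)_μ` (★ TE3 `coeff_satakeTransform_etaOneGraphPartner`, ★ TB3 `coeff_satakeTransform_bcGraphPartner`:
the graphs `z ↦ (z, 1, z⁻¹) ↦ (z, 1)` resp. `(z, 1, 1)` restrict the same three-variable Laurent polynomial to the same line). [cite: Rogawski1990, §4.10 Prop. 4.10.2 p. 58]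
[cite: CartierCorvallis1979, §IV (4.2), Cor. 4.2] -/
theorem coeff_satakeTransform_etaOneGraphPartner_eq_coeff_satakeTransform_bcGraphPartner {ϖE : w.1.adicCompletion E}
    (hd : UnramifiedLocalConjDatum (galAdicCompletionMap (L := E) c hw) ϖE) (φ : heckeAlgebra ℂ (GL (Fin 3) K) (glInt 3 K)) (k : ℤ) :
    (hd.satakeTransform (etaOneGraphPartnerAlgHom c hc1 v w hw hv hϖ hu hwt φ)).coeff (fun i : Fin 2 => k * (1 - 2 * ((i : ℕ) : ℤ))) =
      (hd.satakeTransform (bcGraphPartnerAlgHom c hc1 v w hw hv hϖ hu hwt φ)).coeff (fun i : Fin 3 => k * (1 - ((i : ℕ) : ℤ))) := by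
  rw [coeff_satakeTransform_etaOneGraphPartner c hc1 v w hw hv hϖ hu hwt hd φ k, coeff_satakeTransform_bcGraphPartner c hc1 v w hw hv hϖ hu hwt hd φ k]

/-- **(H.4) THE ε-NORM-FIBRE CELL COUNT IS `u^{2k}` TIMES THE `η̂₁`-PARTNER'S `U(1,1)` SATAKE COEFFICIENT**: ★ TB2d (B.4) read through (H.3) —
`Σ_{μ ∈ e(cells of K̃ϖ^λK̃), μ₀ − μ₂ = k} #{γ : e γ = μ} = u^{2k} · (𝒮_w(η̂₁ c_λ))_{ℓ′_k}` (count letters of ★ TB2a (V4) ∕ ★ TB2d (B.2) VERBATIM): the G̃-side value of the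
hyperbolic clause (★ TB2d (C.3)) is the H-side constant-term coefficient of `η̂₁ c_λ`. [cite: Rogawski1990, §4.10 Prop. 4.10.1 (b), Prop. 4.10.2 pp. 58–59]
[cite: Kottwitz1986BaseChangeUnits, §1 pp. 239–240] -/
theorem cast_sum_normFibre_card_cells_eq_mul_coeff_satakeTransform_etaOneGraphPartner {ϖE : w.1.adicCompletion E}
    (hd : UnramifiedLocalConjDatum (galAdicCompletionMap (L := E) c hw) ϖE) (lam : Fin 3 → ℤ) (k : ℤ) :
    ((∑ μ ∈ ((finite_orbit_quotient (glInt 3 K) (zpowDiagGL hϖ.ne_zero lam)).toFinset.image fun γ => iwasawaExp hϖ γ.out) with μ 0 - μ 2 = k,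
        ((finite_orbit_quotient (glInt 3 K) (zpowDiagGL hϖ.ne_zero lam)).toFinset.filter fun γ => iwasawaExp hϖ γ.out = μ).card : ℕ) : ℂ) =
      ((u ^ (2 * k) : ℂˣ) : ℂ) *
        (hd.satakeTransform (etaOneGraphPartnerAlgHom c hc1 v w hw hv hϖ hu hwt
            (heckeAlgebra.doubleCosetOperator (glInt 3 K) (zpowDiagGL hϖ.ne_zero lam)))).coeff (fun i : Fin 2 => k * (1 - 2 * ((i : ℕ) : ℤ))) := by
  rw [coeff_satakeTransform_etaOneGraphPartner_eq_coeff_satakeTransform_bcGraphPartner c hc1 v w hw hv hϖ hu hwt hd _ k]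
  exact cast_sum_normFibre_card_cells_eq_mul_coeff_satakeTransform_bcGraphPartner c hc1 v w hw hv hϖ hu hwt hd lam k

end Adic

end Summit.HodgeConjecture.HodgeConjecture.R90.S6

end
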